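import Summits.NavierStokesRegularity.TurbBounds.SpectralFormFreeSlip
import Summits.NavierStokesRegularity.TurbBounds.Results.FSU1
import Summits.NavierStokesRegularity.TurbBounds.FSU1.Mode.M05RegimeI

/-!
# FS-U1″ mode lemma — PhiRegime (`TurbBounds/FSU1/Mode/M06PhiRegime.lean`)

Regime I in scaled variables, unimodality of `Φ`, and the two compositions against the certified scalar lines (`regimeI_case`, `PhiInf_le_Phi`).

Cell-made mathematics of FS-PROOF-DRAFT §3 (pub-turb-sos), kernel-checked; generated from the design compose file
`StageF_compose.check.lean` (96c4b9bf…) by `build_mode_split.py`.  HONEST FRAMING: rigorous bounds for the stated PDE and boundary conditions; no claim about physical turbulence beyond the bound.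
-/

open Real intervalIntegral MeasureTheory Set

namespace Summit.NavierStokesRegularity.TurbBounds.FSU1.Mode

open Summit.NavierStokesRegularity.TurbBounds.SpectralFormFreeSlip
open Summit.NavierStokesRegularity.TurbBounds.FSU1
open Summit.NavierStokesRegularity.TurbBounds.Results.FSU1

/-- `y = Ra^{1/12}`: `y¹² = Ra`, `Ra^{5/12} = y⁵`, `√Ra = y⁶`, and `y² ≥ 10` for `Ra ≥ 10⁶`. -/
theorem twelfth_root {Ra : ℝ} (hRa : (10:ℝ) ^ 6 ≤ Ra) :
    ∃ y : ℝ, 0 < y ∧ y ^ 12 = Ra ∧ Ra ^ ((5:ℝ) / 12) = y ^ 5 ∧ Real.sqrt Ra = y ^ 6 ∧ 10 ≤ y ^ 2 := by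
  have hRa0 : 0 < Ra := lt_of_lt_of_le (by norm_num) hRa
  refine ⟨Ra ^ ((1:ℝ) / 12), Real.rpow_pos_of_pos hRa0 _, ?_, ?_, ?_, ?_⟩
  · rw [← Real.rpow_natCast, ← Real.rpow_mul hRa0.le]; norm_num
  · rw [← Real.rpow_natCast, ← Real.rpow_mul hRa0.le]; norm_num
  · rw [← Real.rpow_natCast, ← Real.rpow_mul hRa0.le, Real.sqrt_eq_rpow]; norm_num
  · have hy0 : 0 < Ra ^ ((1:ℝ) / 12) := Real.rpow_pos_of_pos hRa0 _
    have h12 : (Ra ^ ((1:ℝ) / 12)) ^ 12 = Ra := by rw [← Real.rpow_natCast, ← Real.rpow_mul hRa0.le]; norm_num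
    by_contra h
    push Not at h
    have : (Ra ^ ((1:ℝ) / 12)) ^ 12 < 10 ^ 6 := by
      calc (Ra ^ ((1:ℝ) / 12)) ^ 12 = ((Ra ^ ((1:ℝ) / 12)) ^ 2) ^ 6 := by ring
        _ < 10 ^ 6 := pow_lt_pow_left₀ h (by positivity) (by norm_num)
    linarith

/-- Disjoint layers: `D·Ra^{−5/12} ≤ 1/2` for `Ra ≥ 10⁶` once `(2D)¹² ≤ 10³⁰`. -/
theorem delta_le_half' {D Ra : ℝ} (hD12 : (2 * D) ^ 12 ≤ 10 ^ 30) (hRa : (10:ℝ) ^ 6 ≤ Ra) :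
    D / Ra ^ ((5:ℝ) / 12) ≤ 1 / 2 := by
  obtain ⟨y, hy0, hy12, h5, -, hy2⟩ := twelfth_root hRa
  rw [h5, div_le_iff₀ (by positivity)]
  -- 2D ≤ y⁵ since (2D)¹² ≤ 10³⁰ ≤ Ra⁵ = (y⁵)¹²
  have hR5 : (10:ℝ) ^ 30 ≤ (y ^ 5) ^ 12 := by
    have : (10:ℝ) ^ 30 = (10 ^ 6) ^ 5 := by norm_num
    rw [this, show (y ^ 5) ^ 12 = (y ^ 12) ^ 5 by ring, hy12]
    exact pow_le_pow_left₀ (by norm_num) hRa 5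
  by_contra h
  push Not at h
  have h' : y ^ 5 < 2 * D := by linarith
  have : (y ^ 5) ^ 12 < (2 * D) ^ 12 := pow_lt_pow_left₀ h' (by positivity) (by norm_num)
  linarith

/-- The scalar translation: (I₀) at `ρ_I`, `ρ ≥ ρ_I`, `Ra ≥ 10⁶` ⇒ the hypothesis of `lemmaI` at `δ = D·Ra^{−5/12}`. -/
theorem regimeI_hyp {a u D ρI Ra k : ℝ} (ha : 0 < a) (hu1 : u ≤ 1) (hD : 0 < D) (hρI : 0 ≤ ρI)
    (hI0 : (1 / 4 : ℝ) * D ^ 4 / 10 / a ≤ ρI ^ 2 * (π ^ 2 / 4 + (1 - u) * ρI ^ 2) * (π ^ 2 / 2 + ρI ^ 2))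
    (hRa : (10:ℝ) ^ 6 ≤ Ra) (hk : 0 < k) (hρ : ρI ≤ k * (D / Ra ^ ((5:ℝ) / 12))) :
    1 / (4 * (π ^ 2 / (4 * (D / Ra ^ ((5:ℝ) / 12)) ^ 2) + (1 - u) * k ^ 2) * (D / Ra ^ ((5:ℝ) / 12)) ^ 2
        * (k ^ 2 + π ^ 2 / (2 * (D / Ra ^ ((5:ℝ) / 12)) ^ 2))) ≤ a / (Ra * Real.sqrt Ra) * k ^ 2 := by
  obtain ⟨y, hy0, hy12, h5, hs, hy2⟩ := twelfth_root hRa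
  rw [h5] at hρ ⊢
  rw [hs, ← hy12]
  have h1u : 0 ≤ 1 - u := by linarith
  have hδ : 0 < D / y ^ 5 := by positivity
  have hden : 0 < 4 * (π ^ 2 / (4 * (D / y ^ 5) ^ 2) + (1 - u) * k ^ 2) * (D / y ^ 5) ^ 2 * (k ^ 2 + π ^ 2 / (2 * (D / y ^ 5) ^ 2)) := by
    have : 0 ≤ (1 - u) * k ^ 2 := by positivity
    positivity
  rw [div_le_iff₀ hden]
  set ρ : ℝ := k * (D / y ^ 5) with hρdef
  have e : a / (y ^ 12 * y ^ 6) * k ^ 2 * (4 * (π ^ 2 / (4 * (D / y ^ 5) ^ 2) + (1 - u) * k ^ 2) * (D / y ^ 5) ^ 2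
      * (k ^ 2 + π ^ 2 / (2 * (D / y ^ 5) ^ 2)))
      = 4 * a * y ^ 2 / D ^ 4 * (ρ ^ 2 * (π ^ 2 / 4 + (1 - u) * ρ ^ 2) * (π ^ 2 / 2 + ρ ^ 2)) := by
    rw [hρdef]
    field_simp
    ring
  rw [e]
  have hP : ρI ^ 2 * (π ^ 2 / 4 + (1 - u) * ρI ^ 2) * (π ^ 2 / 2 + ρI ^ 2) ≤ ρ ^ 2 * (π ^ 2 / 4 + (1 - u) * ρ ^ 2) * (π ^ 2 / 2 + ρ ^ 2) := by
    have h1 : ρI ^ 2 ≤ ρ ^ 2 := pow_le_pow_left₀ hρI hρ 2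
    have h2 : π ^ 2 / 4 + (1 - u) * ρI ^ 2 ≤ π ^ 2 / 4 + (1 - u) * ρ ^ 2 := by nlinarith
    have h3 : π ^ 2 / 2 + ρI ^ 2 ≤ π ^ 2 / 2 + ρ ^ 2 := by linarith
    exact mul_le_mul (mul_le_mul h1 h2 (by positivity) (by positivity)) h3 (by positivity) (by positivity)
  have hPρ := hI0.trans hP
  have e2 : 4 * a * y ^ 2 / D ^ 4 * ((1 / 4 : ℝ) * D ^ 4 / 10 / a) = y ^ 2 / 10 := by
    field_simp
  have h10 : 1 ≤ y ^ 2 / 10 := by rw [le_div_iff₀ (by norm_num)]; linarith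
  calc (1:ℝ) ≤ y ^ 2 / 10 := h10
    _ = 4 * a * y ^ 2 / D ^ 4 * ((1 / 4 : ℝ) * D ^ 4 / 10 / a) := e2.symm
    _ ≤ _ := mul_le_mul_of_nonneg_left hPρ (by positivity)

/-- **REGIME I of `FSU1ModeLemma`, closed.** For weights/profile parameters satisfying the relevant scalar lines of `ScalarLines`
(`a > 0`, `0 < u_I ≤ 1`, `b − a²/(4u_I) ≥ 0`, `D > 0`, `(2D)¹² ≤ 10³⁰`, `ρ_I ≥ 0`, (I₀)), every `Ra ≥ 10⁶`, every wavenumber with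
`ρ = k·D·Ra^{−5/12} ≥ ρ_I`, and the two-layer profile of thickness `δ = D·Ra^{−5/12}`: `fsModeForm ≥ 0` on the free-slip class. -/
theorem fsModeForm_nonneg_of_rho_ge {a b u D ρI Ra k : ℝ} {τp v θ : ℝ → ℝ} (hp : FreeSlipPair v θ)
    (ha : 0 < a) (hu0 : 0 < u) (hu1 : u ≤ 1) (hbu : 0 ≤ b - a ^ 2 / (4 * u)) (hD : 0 < D) (hD12 : (2 * D) ^ 12 ≤ 10 ^ 30)
    (hρI : 0 ≤ ρI) (hI0 : (1 / 4 : ℝ) * D ^ 4 / 10 / a ≤ ρI ^ 2 * (π ^ 2 / 4 + (1 - u) * ρI ^ 2) * (π ^ 2 / 2 + ρI ^ 2))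
    (hRa : (10:ℝ) ^ 6 ≤ Ra) (hk : 0 < k) (hρ : ρI ≤ k * (D / Ra ^ ((5:ℝ) / 12)))
    (hL : EqOn τp (fun _ => -(1 / (2 * (D / Ra ^ ((5:ℝ) / 12))))) (Ioo 0 (D / Ra ^ ((5:ℝ) / 12))))
    (hM : EqOn τp (fun _ => 0) (Ioo (D / Ra ^ ((5:ℝ) / 12)) (1 - D / Ra ^ ((5:ℝ) / 12))))
    (hR : EqOn τp (fun _ => -(1 / (2 * (D / Ra ^ ((5:ℝ) / 12))))) (Ioo (1 - D / Ra ^ ((5:ℝ) / 12)) 1)) :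
    0 ≤ fsModeForm Ra a b τp k v θ := by
  have hRa0 : 0 < Ra := lt_of_lt_of_le (by norm_num) hRa
  have hδ : 0 < D / Ra ^ ((5:ℝ) / 12) := div_pos hD (Real.rpow_pos_of_pos hRa0 _)
  have hδ2 := delta_le_half' hD12 hRa
  exact fsModeForm_nonneg_regimeI hp hRa0 ha hk hu0 hu1 hbu hδ hδ2 hL hM hR (regimeI_hyp ha hu1 hD hρI hI0 hRa hk hρ)

/-- `Φ` over real parameters: `phiR a c κ = 2a(κ + √(κ²+c))²/κ` (`= FSU1.Phi p κ` for `a = p.a`, `c = p.c`). -/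
noncomputable def phiR (a c κ : ℝ) : ℝ := 2 * a * (κ + Real.sqrt (κ ^ 2 + c)) ^ 2 / κ

/-- The square-root facts at `κ`: `s ≥ 0`, `s² = κ² + c`, `κ < s`, and `w² − c = 2κw` for `w = κ + s`. -/
theorem sqrt_facts {c κ : ℝ} (hc : 0 < c) (_hκ : 0 ≤ κ) :
    0 ≤ Real.sqrt (κ ^ 2 + c) ∧ Real.sqrt (κ ^ 2 + c) ^ 2 = κ ^ 2 + c ∧ κ < Real.sqrt (κ ^ 2 + c) ∧
      (κ + Real.sqrt (κ ^ 2 + c)) ^ 2 - c = 2 * κ * (κ + Real.sqrt (κ ^ 2 + c)) := by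
  have hs0 : 0 ≤ Real.sqrt (κ ^ 2 + c) := Real.sqrt_nonneg _
  have hs2 : Real.sqrt (κ ^ 2 + c) ^ 2 = κ ^ 2 + c := Real.sq_sqrt (by positivity)
  have hks : κ < Real.sqrt (κ ^ 2 + c) := by
    by_contra h
    push Not at h
    have := mul_self_le_mul_self hs0 h
    nlinarith
  exact ⟨hs0, hs2, hks, by nlinarith⟩

/-- Global minimum: `Φ(κ) ≥ 6√(3a·(ac))` for every `κ > 0`. -/
theorem phiR_ge_min {a c κ : ℝ} (ha : 0 < a) (hc : 0 < c) (hκ : 0 < κ) :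
    6 * Real.sqrt (3 * a * (a * c)) ≤ phiR a c κ := by
  obtain ⟨hs0, hs2, hks, hw⟩ := sqrt_facts hc hκ.le
  set s := Real.sqrt (κ ^ 2 + c)
  set w := κ + s with hwdef
  have hw0 : 0 < w := by rw [hwdef]; linarith
  set r := Real.sqrt (3 * c) with hrdef
  have hr0 : 0 ≤ r := Real.sqrt_nonneg _
  have hr2 : r ^ 2 = 3 * c := Real.sq_sqrt (by positivity)
  have hsq : Real.sqrt (3 * a * (a * c)) = a * r := by
    rw [hrdef, show 3 * a * (a * c) = a ^ 2 * (3 * c) by ring, Real.sqrt_mul (by positivity), Real.sqrt_sq ha.le]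
  rw [hsq, phiR, le_div_iff₀ hκ]
  -- w·(2a w² − 6 a r κ) = 2a w³ − 3ar(w² − c) = a (w − r)²(2w + r) ≥ 0
  have key : 0 ≤ a * ((w - r) ^ 2 * (2 * w + r)) := by positivity
  have e : w * (2 * a * w ^ 2 - 6 * (a * r) * κ) = a * ((w - r) ^ 2 * (2 * w + r)) := by
    have h3 : 3 * (a * r) * c = a * r ^ 3 := by rw [pow_succ, hr2]; ring
    linear_combination (-(3 * a * r)) * hw + h3 + (6 * a * r) * hs2
  have : 0 ≤ 2 * a * w ^ 2 - 6 * (a * r) * κ := by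
    rw [← mul_nonneg_iff_of_pos_left hw0, e]; exact key
  linarith

/-- The comparison numerator: `4w₁w₂(w₁²κ₂ − w₂²κ₁) = 2(w₁³(w₂² − c) − w₂³(w₁² − c))`. -/
theorem phi_compare {c κ₁ κ₂ w₁ w₂ : ℝ} (h1 : w₁ ^ 2 - c = 2 * κ₁ * w₁) (h2 : w₂ ^ 2 - c = 2 * κ₂ * w₂) :
    4 * w₁ * w₂ * (w₁ ^ 2 * κ₂ - w₂ ^ 2 * κ₁) = 2 * (w₁ ^ 3 * (w₂ ^ 2 - c) - w₂ ^ 3 * (w₁ ^ 2 - c)) := by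
  linear_combination (2 * w₂ ^ 3) * h1 - (2 * w₁ ^ 3) * h2

/-- `w² ≤ 3c` iff `κ² ≤ c/3` (forward direction), for `κ ≥ 0`. -/
theorem w_sq_le {c κ : ℝ} (hc : 0 < c) (hκ : 0 ≤ κ) (h : κ ^ 2 ≤ c / 3) :
    (κ + Real.sqrt (κ ^ 2 + c)) ^ 2 ≤ 3 * c := by
  obtain ⟨hs0, hs2, _, _⟩ := sqrt_facts hc hκ
  set s := Real.sqrt (κ ^ 2 + c)
  -- κ s ≤ c − κ²
  have hpos : 0 ≤ c - κ ^ 2 := by linarith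
  have hsq : (κ * s) ^ 2 ≤ (c - κ ^ 2) ^ 2 := by
    rw [mul_pow, hs2]; nlinarith
  have hks : κ * s ≤ c - κ ^ 2 := (pow_le_pow_iff_left₀ (by positivity) hpos two_ne_zero).mp hsq
  nlinarith

/-- `3c ≤ w²` when `c/3 ≤ κ²`, for `κ ≥ 0`. -/
theorem le_w_sq {c κ : ℝ} (hc : 0 < c) (hκ : 0 ≤ κ) (h : c / 3 ≤ κ ^ 2) :
    3 * c ≤ (κ + Real.sqrt (κ ^ 2 + c)) ^ 2 := by
  obtain ⟨hs0, hs2, _, _⟩ := sqrt_facts hc hκ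
  set s := Real.sqrt (κ ^ 2 + c)
  by_cases hneg : c - κ ^ 2 ≤ 0
  · nlinarith [mul_nonneg hκ hs0]
  · push Not at hneg
    have hsq : (c - κ ^ 2) ^ 2 ≤ (κ * s) ^ 2 := by
      rw [mul_pow, hs2]; nlinarith
    have hks : c - κ ^ 2 ≤ κ * s := (pow_le_pow_iff_left₀ hneg.le (by positivity) two_ne_zero).mp hsq
    nlinarith

/-- `Φ` is decreasing on `(0, κ*]`: `0 < κ₁ ≤ κ₂`, `κ₂² ≤ c/3` ⇒ `Φ(κ₂) ≤ Φ(κ₁)`. -/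
theorem phiR_anti_left {a c κ₁ κ₂ : ℝ} (ha : 0 < a) (hc : 0 < c) (hκ₁ : 0 < κ₁) (h12 : κ₁ ≤ κ₂) (h2 : κ₂ ^ 2 ≤ c / 3) :
    phiR a c κ₂ ≤ phiR a c κ₁ := by
  have hκ₂ : 0 < κ₂ := lt_of_lt_of_le hκ₁ h12
  obtain ⟨hs10, hs12, hks1, hw1⟩ := sqrt_facts hc hκ₁.le
  obtain ⟨hs20, hs22, hks2, hw2⟩ := sqrt_facts hc hκ₂.le
  have hw2sq := w_sq_le hc hκ₂.le h2
  set s₁ := Real.sqrt (κ₁ ^ 2 + c)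
  set s₂ := Real.sqrt (κ₂ ^ 2 + c)
  have hss : s₁ ≤ s₂ := Real.sqrt_le_sqrt (by nlinarith)
  set w₁ := κ₁ + s₁ with hw₁
  set w₂ := κ₂ + s₂ with hw₂
  have hw10 : 0 < w₁ := by rw [hw₁]; linarith
  have hw20 : 0 < w₂ := by rw [hw₂]; linarith
  have hw12 : w₁ ≤ w₂ := by rw [hw₁, hw₂]; linarith
  -- bracket ≤ 0 and N ≥ 0
  have hb : w₁ ^ 2 * w₂ ^ 2 - c * (w₁ ^ 2 + w₁ * w₂ + w₂ ^ 2) ≤ 0 := by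
    have := mul_le_mul_of_nonneg_left hw2sq (sq_nonneg w₁)
    nlinarith [mul_nonneg (mul_nonneg hc.le (sub_nonneg.mpr hw12)) (by positivity : (0:ℝ) ≤ 2 * w₁ + w₂)]
  have hN : 0 ≤ w₁ ^ 3 * (w₂ ^ 2 - c) - w₂ ^ 3 * (w₁ ^ 2 - c) := by
    nlinarith [mul_nonneg (sub_nonneg.mpr hw12) (neg_nonneg.mpr hb)]
  have hcmp := phi_compare hw1 hw2
  have hmain : 0 ≤ w₁ ^ 2 * κ₂ - w₂ ^ 2 * κ₁ := by
    have h4 : 0 < 4 * w₁ * w₂ := by positivity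
    rw [← mul_nonneg_iff_of_pos_left h4, hcmp]; linarith
  simp only [phiR]
  rw [div_le_div_iff₀ hκ₂ hκ₁]
  nlinarith [mul_le_mul_of_nonneg_left (sub_nonneg.mp hmain) (by positivity : (0:ℝ) ≤ 2 * a)]

/-- `Φ` is increasing on `[κ*, ∞)`: `0 < κ₁ ≤ κ₂`, `c/3 ≤ κ₁²` ⇒ `Φ(κ₁) ≤ Φ(κ₂)`. -/
theorem phiR_mono_right {a c κ₁ κ₂ : ℝ} (ha : 0 < a) (hc : 0 < c) (hκ₁ : 0 < κ₁) (h12 : κ₁ ≤ κ₂) (h1 : c / 3 ≤ κ₁ ^ 2) :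
    phiR a c κ₁ ≤ phiR a c κ₂ := by
  have hκ₂ : 0 < κ₂ := lt_of_lt_of_le hκ₁ h12
  obtain ⟨hs10, hs12, hks1, hw1⟩ := sqrt_facts hc hκ₁.le
  obtain ⟨hs20, hs22, hks2, hw2⟩ := sqrt_facts hc hκ₂.le
  have hw1sq := le_w_sq hc hκ₁.le h1
  set s₁ := Real.sqrt (κ₁ ^ 2 + c)
  set s₂ := Real.sqrt (κ₂ ^ 2 + c)
  have hss : s₁ ≤ s₂ := Real.sqrt_le_sqrt (by nlinarith)
  set w₁ := κ₁ + s₁ with hw₁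
  set w₂ := κ₂ + s₂ with hw₂
  have hw10 : 0 < w₁ := by rw [hw₁]; linarith
  have hw20 : 0 < w₂ := by rw [hw₂]; linarith
  have hw12 : w₁ ≤ w₂ := by rw [hw₁, hw₂]; linarith
  have hb : 0 ≤ w₁ ^ 2 * w₂ ^ 2 - c * (w₁ ^ 2 + w₁ * w₂ + w₂ ^ 2) := by
    have := mul_le_mul_of_nonneg_left hw1sq (sq_nonneg w₂)
    nlinarith [mul_nonneg (mul_nonneg hc.le (sub_nonneg.mpr hw12)) (by positivity : (0:ℝ) ≤ w₁ + 2 * w₂)]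
  have hN : w₁ ^ 3 * (w₂ ^ 2 - c) - w₂ ^ 3 * (w₁ ^ 2 - c) ≤ 0 := by
    nlinarith [mul_nonneg (sub_nonneg.mpr hw12) hb]
  have hcmp := phi_compare hw1 hw2
  have hmain : w₁ ^ 2 * κ₂ - w₂ ^ 2 * κ₁ ≤ 0 := by
    have h4 : 0 < 4 * w₁ * w₂ := by positivity
    have : 4 * w₁ * w₂ * (w₁ ^ 2 * κ₂ - w₂ ^ 2 * κ₁) ≤ 0 := by rw [hcmp]; linarith
    by_contra h
    push Not at h
    have := mul_pos h4 h
    linarith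
  simp only [phiR]
  rw [div_le_div_iff₀ hκ₁ hκ₂]
  nlinarith [mul_le_mul_of_nonneg_left (sub_nonpos.mp hmain) (by positivity : (0:ℝ) ≤ 2 * a)]

/-- **Regime I of `FSU1ModeLemma`, unconditionally**: for any parameters satisfying `ScalarLines`, any `Ra ≥ 10⁶`, any wavenumber with
`ρ = k·δ ≥ ρ_I`, the sign-free free-slip mode functional with the two-layer profile `tauFS p.D Ra` is non-negative on the free-slip class. -/
theorem regimeI_case (p : Params) (hS : ScalarLines p) {Ra : ℝ} (hRa : (10 : ℝ) ^ 6 ≤ Ra) {k : ℝ} (hk : 0 < k)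
    (hρ : (p.rhoI : ℝ) ≤ k * delta p.D Ra) {v θ : ℝ → ℝ} (hp : FreeSlipPair v θ) :
    0 ≤ fsModeForm Ra p.a p.b (tauFS p.D Ra) k v θ := by
  obtain ⟨ha, hb, _hb1, _hab, hu_lo, hu_hi, hD, hD12, hρI, _hρI1, _hks, hI0, _hedge, _hkc⟩ := hS
  have ha' : (0 : ℝ) < p.a := by exact_mod_cast ha
  have hu0q : (0 : ℚ) < p.uI := lt_of_lt_of_le (by positivity) hu_lo
  have hu0' : (0 : ℝ) < p.uI := by exact_mod_cast hu0q
  have hu1' : (p.uI : ℝ) ≤ 1 := by exact_mod_cast hu_hi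
  have hbuq : (0 : ℚ) ≤ p.b - p.a ^ 2 / (4 * p.uI) := by
    have h1 : p.a ^ 2 ≤ p.uI * (4 * p.b) := (div_le_iff₀ (by positivity)).mp hu_lo
    have h2 : p.a ^ 2 / (4 * p.uI) ≤ p.b := by rw [div_le_iff₀ (by positivity)]; linarith
    linarith
  have hbu' : (0 : ℝ) ≤ p.b - p.a ^ 2 / (4 * p.uI) := by exact_mod_cast hbuq
  have hD' : (0 : ℝ) < p.D := by exact_mod_cast hD
  have hD12' : (2 * (p.D : ℝ)) ^ 12 ≤ 10 ^ 30 := by exact_mod_cast hD12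
  have hρI' : (0 : ℝ) ≤ p.rhoI := by exact_mod_cast hρI.le
  have hδ2 : delta p.D Ra ≤ 1 / 2 := delta_le_half' hD12' hRa
  exact fsModeForm_nonneg_of_rho_ge hp ha' hu0' hu1' hbu' hD' hD12' hρI' hI0 hRa hk hρ
    (tauLayer_eqOn_left _) (tauLayer_eqOn_mid _) (tauLayer_eqOn_right hδ2)

/-- `Phi p` is `phiR p.a p.c`. -/
theorem Phi_eq_phiR (p : Params) (κ : ℝ) : Phi p κ = phiR p.a p.c κ := rfl

/-- **`inf Φ` over a cell by unimodality** (justifies the three branches of `PhiInf`): for `a > 0`, `b′ > 0` (i.e. `a² < 4b`), a cell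
`[κa, κb]` with `κa ≥ 0` and any `κ ∈ [κa, κb]`, `κ > 0`: `PhiInf p κa κb ≤ Φ(κ)`. -/
theorem PhiInf_le_Phi (p : Params) (ha : 0 < p.a) (hab : p.a ^ 2 < 4 * p.b) {ka kb : ℚ} {κ : ℝ}
    (hka : 0 ≤ ka) (h1 : (ka : ℝ) ≤ κ) (h2 : κ ≤ kb) (hκ : 0 < κ) : PhiInf p ka kb ≤ Phi p κ := by
  have hbp : 0 < p.bp := by unfold Params.bp; linarith
  have hcq : 0 < p.c := by unfold Params.c; positivity
  have ha' : (0 : ℝ) < p.a := by exact_mod_cast ha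
  have hc' : (0 : ℝ) < p.c := by exact_mod_cast hcq
  have hacq : p.a * p.c = p.bp := by unfold Params.c; field_simp
  have hac : (p.a : ℝ) * (p.c : ℝ) = (p.bp : ℝ) := by exact_mod_cast hacq
  unfold PhiInf
  split_ifs with hA hB
  · -- κ ≤ κb ≤ κ*: decreasing branch
    have hA' : ((kb : ℚ) : ℝ) ^ 2 ≤ (p.c : ℝ) / 3 := by
      have : kb ^ 2 ≤ p.c / 3 := by unfold Params.kstar2 at hA; exact hA
      exact_mod_cast this
    rw [Phi_eq_phiR, Phi_eq_phiR]
    exact phiR_anti_left ha' hc' hκ h2 hA'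
  · -- κ* ≤ κa ≤ κ: increasing branch
    have hB' : (p.c : ℝ) / 3 ≤ ((ka : ℚ) : ℝ) ^ 2 := by
      have : p.c / 3 ≤ ka ^ 2 := by unfold Params.kstar2 at hB; exact hB
      exact_mod_cast this
    have hka0 : (0 : ℝ) < ka := by
      have hka' : (0 : ℝ) ≤ ka := by exact_mod_cast hka
      rcases hka'.eq_or_lt with h | h
      · rw [← h] at hB'; norm_num at hB'; linarith
      · exact h
    rw [Phi_eq_phiR, Phi_eq_phiR]
    exact phiR_mono_right ha' hc' hka0 h1 hB'
  · -- the cell straddles κ*: global minimum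
    rw [Phi_eq_phiR, ← hac]
    exact phiR_ge_min ha' hc' hκ

end Summit.NavierStokesRegularity.TurbBounds.FSU1.Mode
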